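import Literature.AlgebraicGeometry.Resolution.PointBlowupShadeCentres
import HarnessLib

/-!
# `degIn`, `ordAlong`, `chartExponent`, `chartTransform` of a coordinate-subspace centre — the evaluation kit

`Literature/AlgebraicGeometry/Resolution/CentreBlowupOrdAlongBasics.lean` (HIRONAKA-L discharge lane,
librarian res-D-lib-2, dedupe hoist; DEF-FREE). The four notions of
`PointBlowupShadeCentres.lean` §1 (Hauser–Perlega's blow-up in a coordinate-subspace centre
`C_S = {x = 0, yᵢ = 0 (i ∈ S)}`):

* `CentreBlowup.degIn S d = Σ_{i∈S} dᵢ` — the `I(C_S)`-adic order of the monomial `y^d`;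
* `CentreBlowup.ordAlong S F` — "`ord_P`", the least `S`-degree of a monomial of `F` (`⊤` for `F = 0`);
* `CentreBlowup.chartExponent q S j d` — the exponent law of the `y_j`-chart, `d'_j = Σ_{i∈S} dᵢ − q`,
  `d'_i = dᵢ (i ≠ j)` ("`xᵢ ↦ x₁xᵢ` for `i ∈ S`" followed by division by `x₁^q`);
* `CentreBlowup.chartTransform q S j F` — the chart transform, monomial by monomial;

[cite: HauserPerlega2019PRIMS, §2 (permissible blowups, `ord_P`; the blowup in the x₁-chart)],
are EVALUATED here once, for an ARBITRARY index type `σ` and commutative coefficient ring `K`: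

* §1 `degIn` on `∅`, singletons, pairs, triples, `insert`, disjoint unions, `Finsupp.single`, `0`,
  `n • d`; monotonicity in `S`; `degIn S d = |d|` when `d` is supported in `S`;
* §2 `chartExponent` coordinatewise (`ite` form, at `j`, off `j`) and the extensionality criterion
  `chartExponent q S j d = d' ↔ d' j = degIn S d − q ∧ ∀ i ≠ j, d' i = d i`;
* §3 `ordAlong`: the `le`/`inf` interface, monotonicity in `S`, `ordAlong S 0 = ⊤` and
  `ordAlong S F = ⊤ ↔ F = 0`, monomials, `X_i^n`, two-monomial sums (the shape of every example
  polynomial of the Hauser–Perlega cycles), super-additivity on sums and products;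
* §4 `chartTransform`: zero, additivity, finite sums, `C c • _`, monomials, two-monomial sums.

WHY (librarian's census 2026-08-27T12:0xZ): the `Fin 4` / `Fin 5` instances of these one-liners were
re-proved privately in ≥ 12 files of ≥ 3 author lineages (`degIn_pair₄` ×8, `degIn_singleton₄` ×7,
`chartExponent_V4` ×6, `degIn_013/023/123` ×5, `chartExponent_V4_eq` ×5, `degIn_pair'`,
`chartExponent_apply_of_ne'`, `centre_chartExponent_apply'`, …). The point-blow-up (`S = univ`)
versions live in `PointBlowupMohBound.lean` (`PointBlowup.chartExponent_apply`) and
`PointBlowupFlagTranslatedStep.lean` (`HauserPerlega2024.chartTransform_add/…`); the additive /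
degree lemmas `degIn_add`, `degIn_le_degree`, `apply_le_degIn`, `degIn_le_degIn_of_le`,
`ordAlong_univ`, `chartTransform_univ` are in `CentreBlowupMohStability.lean` and are NOT restated.

Nothing here is a statement about resolution of singularities; these are bookkeeping identities of
finite sums and supports.
-/

open MvPolynomial Finset

open scoped BigOperators

namespace Literature.AlgebraicGeometry.Resolution

namespace CentreBlowup

variable {σ : Type*} {K : Type*} [CommRing K]

/-! ## §1 Evaluating `degIn S d = Σ_{i∈S} dᵢ` -/

section DegIn

/-- `Σ_{i∈∅} dᵢ = 0`. [cite: HauserPerlega2019PRIMS, §2 (ord_P of a monomial)] -/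
theorem degIn_empty (d : σ →₀ ℕ) : degIn (∅ : Finset σ) d = 0 := Finset.sum_empty

/-- `Σ_{i∈{i}} dᵢ = dᵢ`. [cite: HauserPerlega2019PRIMS, §2 (ord_P of a monomial)] -/
theorem degIn_singleton (i : σ) (d : σ →₀ ℕ) : degIn {i} d = d i := Finset.sum_singleton _ _

/-- `Σ_{l∈{i,j}} d_l = dᵢ + dⱼ` for `i ≠ j`. [cite: HauserPerlega2019PRIMS, §2 (ord_P of a monomial)] -/
theorem degIn_pair [DecidableEq σ] {i j : σ} (hij : i ≠ j) (d : σ →₀ ℕ) :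
    degIn {i, j} d = d i + d j := Finset.sum_pair hij

/-- `Σ_{l ∈ insert i S} d_l = dᵢ + Σ_{l∈S} d_l` for `i ∉ S`.
[cite: HauserPerlega2019PRIMS, §2 (ord_P of a monomial)] -/
theorem degIn_insert [DecidableEq σ] {i : σ} {S : Finset σ} (hi : i ∉ S) (d : σ →₀ ℕ) :
    degIn (insert i S) d = d i + degIn S d := Finset.sum_insert hi

/-- `Σ_{l∈{i,j,k}} d_l = dᵢ + dⱼ + d_k` for pairwise distinct `i, j, k` (e.g. `degIn {0,1,3} d` on `Fin 4`,
with the three disequalities by `decide`). [cite: HauserPerlega2019PRIMS, §2 (ord_P of a monomial)] -/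
theorem degIn_triple [DecidableEq σ] {i j k : σ} (hij : i ≠ j) (hik : i ≠ k) (hjk : j ≠ k)
    (d : σ →₀ ℕ) : degIn {i, j, k} d = d i + d j + d k := by
  rw [degIn, Finset.sum_insert (by simp [hij, hik]), Finset.sum_pair hjk, add_assoc]

/-- `degIn` over a disjoint union splits. [cite: HauserPerlega2019PRIMS, §2 (ord_P of a monomial)] -/
theorem degIn_union_of_disjoint [DecidableEq σ] {S T : Finset σ} (h : Disjoint S T) (d : σ →₀ ℕ) :
    degIn (S ∪ T) d = degIn S d + degIn T d := Finset.sum_union h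

/-- The zero exponent has `S`-degree `0`. [cite: HauserPerlega2019PRIMS, §2 (ord_P of a monomial)] -/
theorem degIn_zero (S : Finset σ) : degIn S (0 : σ →₀ ℕ) = 0 := by
  simp [degIn]

/-- `S`-degree of `n·e_i`: `n` if `i ∈ S`, else `0`. [cite: HauserPerlega2019PRIMS, §2 (ord_P of a monomial)] -/
theorem degIn_single [DecidableEq σ] (S : Finset σ) (i : σ) (n : ℕ) :
    degIn S (Finsupp.single i n) = if i ∈ S then n else 0 := by
  unfold degIn
  simp only [Finsupp.single_apply]
  rw [Finset.sum_ite_eq]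

/-- `S`-degree of `n·e_i` for `i ∈ S`. [cite: HauserPerlega2019PRIMS, §2 (ord_P of a monomial)] -/
theorem degIn_single_of_mem [DecidableEq σ] {S : Finset σ} {i : σ} (hi : i ∈ S) (n : ℕ) :
    degIn S (Finsupp.single i n) = n := by
  rw [degIn_single, if_pos hi]

/-- `S`-degree of `n·e_i` for `i ∉ S`. [cite: HauserPerlega2019PRIMS, §2 (ord_P of a monomial)] -/
theorem degIn_single_of_not_mem [DecidableEq σ] {S : Finset σ} {i : σ} (hi : i ∉ S) (n : ℕ) :
    degIn S (Finsupp.single i n) = 0 := by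
  rw [degIn_single, if_neg hi]

/-- `degIn` is homogeneous: `Σ_{i∈S} (n·d)ᵢ = n · Σ_{i∈S} dᵢ`.
[cite: HauserPerlega2019PRIMS, §2 (ord_P of a monomial)] -/
theorem degIn_nsmul (S : Finset σ) (n : ℕ) (d : σ →₀ ℕ) : degIn S (n • d) = n * degIn S d := by
  simp only [degIn, Finsupp.coe_smul, Pi.smul_apply, smul_eq_mul, Finset.mul_sum]

/-- `degIn` is monotone in the coordinate set. [cite: HauserPerlega2019PRIMS, §2 (ord_P of a monomial)] -/
theorem degIn_mono {S T : Finset σ} (hST : S ⊆ T) (d : σ →₀ ℕ) : degIn S d ≤ degIn T d :=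
  Finset.sum_le_sum_of_subset hST

/-- `Σ_{i∈S} dᵢ = 0` iff every `dᵢ`, `i ∈ S`, vanishes. [cite: HauserPerlega2019PRIMS, §2 (ord_P of a monomial)] -/
theorem degIn_eq_zero_iff {S : Finset σ} {d : σ →₀ ℕ} : degIn S d = 0 ↔ ∀ i ∈ S, d i = 0 :=
  Finset.sum_eq_zero_iff

/-- A monomial supported inside `S` has `S`-degree equal to its total degree.
[cite: HauserPerlega2019PRIMS, §2 (ord_P of a monomial)] -/
theorem degIn_eq_degree_of_support_subset {S : Finset σ} {d : σ →₀ ℕ} (h : d.support ⊆ S) :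
    degIn S d = d.degree := by
  rw [degIn, Finsupp.degree_apply]
  exact (Finset.sum_subset h fun i _ hi => Finsupp.notMem_support_iff.mp hi).symm

/-- A monomial all of whose exponents outside `S` vanish has `S`-degree equal to its total degree.
[cite: HauserPerlega2019PRIMS, §2 (ord_P of a monomial)] -/
theorem degIn_eq_degree_of_apply_eq_zero (S : Finset σ) (d : σ →₀ ℕ) (h : ∀ i, i ∉ S → d i = 0) :
    degIn S d = d.degree :=
  degIn_eq_degree_of_support_subset fun i hi => by
    by_contra hiS
    exact (Finsupp.mem_support_iff.mp hi) (h i hiS)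

end DegIn

/-! ## §2 `chartExponent` coordinatewise -/

section ChartExponent

variable [DecidableEq σ]

/-- The chart law of `Bl_{C_S}` in the `y_j`-chart, coordinatewise (`ite` form).
[cite: HauserPerlega2019PRIMS, §2 (the blowup in the x₁-chart)] -/
theorem chartExponent_apply (q : ℕ) (S : Finset σ) (j : σ) (d : σ →₀ ℕ) (i : σ) :
    chartExponent q S j d i = if i = j then degIn S d - q else d i := by
  unfold chartExponent
  rw [Finsupp.update_apply]

/-- The chart exponent at the chart variable: `d'_j = Σ_{i∈S} dᵢ − q`.
[cite: HauserPerlega2019PRIMS, §2 (the blowup in the x₁-chart)] -/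
theorem chartExponent_apply_self (q : ℕ) (S : Finset σ) (j : σ) (d : σ →₀ ℕ) :
    chartExponent q S j d j = degIn S d - q := by
  rw [chartExponent_apply, if_pos rfl]

/-- The chart exponent off the chart variable: `d'_i = dᵢ`.
[cite: HauserPerlega2019PRIMS, §2 (the blowup in the x₁-chart)] -/
theorem chartExponent_apply_of_ne (q : ℕ) (S : Finset σ) {j i : σ} (hij : i ≠ j) (d : σ →₀ ℕ) :
    chartExponent q S j d i = d i := by
  rw [chartExponent_apply, if_neg hij]

/-- **Extensionality criterion** — "the chart law on all coordinates at once": `chartExponent q S j d = d'`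
iff `d'_j = Σ_{i∈S} dᵢ − q` and `d'_i = dᵢ` for `i ≠ j`.
[cite: HauserPerlega2019PRIMS, §2 (the blowup in the x₁-chart)] -/
theorem chartExponent_eq_iff (q : ℕ) (S : Finset σ) (j : σ) (d d' : σ →₀ ℕ) :
    chartExponent q S j d = d' ↔ d' j = degIn S d - q ∧ ∀ i, i ≠ j → d' i = d i := by
  constructor
  · rintro rfl
    exact ⟨chartExponent_apply_self q S j d, fun i hi => chartExponent_apply_of_ne q S hi d⟩
  · rintro ⟨hj, hne⟩
    ext i
    by_cases hi : i = j
    · subst hi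
      rw [chartExponent_apply_self, hj]
    · rw [chartExponent_apply_of_ne q S hi, hne i hi]

/-- The chart exponent of the zero exponent is zero. [cite: HauserPerlega2019PRIMS, §2 (the blowup in the x₁-chart)] -/
theorem chartExponent_zero (q : ℕ) (S : Finset σ) (j : σ) : chartExponent q S j (0 : σ →₀ ℕ) = 0 := by
  rw [chartExponent_eq_iff]
  exact ⟨by rw [degIn_zero, Nat.zero_sub, Finsupp.coe_zero, Pi.zero_apply], fun _ _ => rfl⟩

end ChartExponent

/-! ## §3 `ordAlong S F` — the order of `F` along `C_S` -/

section OrdAlong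

/-- Unfolding: `ordAlong S F = inf_{d ∈ supp F} Σ_{i∈S} dᵢ`. [cite: HauserPerlega2019PRIMS, §2 (ord_P)] -/
theorem ordAlong_eq_inf (S : Finset σ) (F : MvPolynomial σ K) :
    ordAlong S F = F.support.inf fun d => (degIn S d : ℕ∞) := rfl

/-- `n ≤ ordAlong S F` iff every monomial of `F` has `S`-degree `≥ n`. [cite: HauserPerlega2019PRIMS, §2 (ord_P)] -/
theorem le_ordAlong_iff {S : Finset σ} {F : MvPolynomial σ K} {n : ℕ∞} :
    n ≤ ordAlong S F ↔ ∀ d ∈ F.support, n ≤ (degIn S d : ℕ∞) :=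
  Finset.le_inf_iff

/-- A uniform lower bound on the `S`-degrees of the monomials of `F` bounds `ordAlong S F` from below.
[cite: HauserPerlega2019PRIMS, §2 (ord_P)] -/
theorem le_ordAlong_of_forall {S : Finset σ} {F : MvPolynomial σ K} {n : ℕ}
    (h : ∀ d ∈ F.support, n ≤ degIn S d) : (n : ℕ∞) ≤ ordAlong S F :=
  le_ordAlong_iff.mpr fun d hd => by exact_mod_cast h d hd

/-- A monomial of `F` bounds `ordAlong S F` from above by its `S`-degree. [cite: HauserPerlega2019PRIMS, §2 (ord_P)] -/
theorem ordAlong_le_of_mem_support {S : Finset σ} {F : MvPolynomial σ K} {d : σ →₀ ℕ}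
    (hd : d ∈ F.support) : ordAlong S F ≤ (degIn S d : ℕ∞) :=
  Finset.inf_le hd

/-- A non-zero coefficient of `F` bounds `ordAlong S F` from above. [cite: HauserPerlega2019PRIMS, §2 (ord_P)] -/
theorem ordAlong_le_of_coeff_ne_zero {S : Finset σ} {F : MvPolynomial σ K} {d : σ →₀ ℕ}
    (hd : coeff d F ≠ 0) : ordAlong S F ≤ (degIn S d : ℕ∞) :=
  ordAlong_le_of_mem_support (MvPolynomial.mem_support_iff.mpr hd)

/-- `ordAlong` is monotone in the coordinate set: a larger `S` (a smaller centre `C_S`) gives a larger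
order. [cite: HauserPerlega2019PRIMS, §2 (ord_P)] -/
theorem ordAlong_mono {S T : Finset σ} (hST : S ⊆ T) (F : MvPolynomial σ K) :
    ordAlong S F ≤ ordAlong T F :=
  le_ordAlong_iff.mpr fun d hd => le_trans (ordAlong_le_of_mem_support hd)
    (by exact_mod_cast degIn_mono hST d)

/-- `ordAlong S 0 = ⊤`. [cite: HauserPerlega2019PRIMS, §2 (ord_P)] -/
theorem ordAlong_zero (S : Finset σ) : ordAlong S (0 : MvPolynomial σ K) = ⊤ := by
  rw [ordAlong_eq_inf, MvPolynomial.support_zero, Finset.inf_empty]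

/-- For `F ≠ 0` the order along `C_S` is attained at a monomial of `F`. [cite: HauserPerlega2019PRIMS, §2 (ord_P)] -/
theorem exists_mem_support_ordAlong_eq (S : Finset σ) {F : MvPolynomial σ K} (hF : F ≠ 0) :
    ∃ d ∈ F.support, ordAlong S F = (degIn S d : ℕ∞) :=
  Finset.exists_mem_eq_inf _ (MvPolynomial.support_nonempty.mpr hF) _

/-- `ordAlong S F` is finite for `F ≠ 0`. [cite: HauserPerlega2019PRIMS, §2 (ord_P)] -/
theorem ordAlong_ne_top {S : Finset σ} {F : MvPolynomial σ K} (hF : F ≠ 0) : ordAlong S F ≠ ⊤ := by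
  obtain ⟨d, -, hd⟩ := exists_mem_support_ordAlong_eq S hF
  rw [hd]
  exact ENat.coe_ne_top _

/-- `ordAlong S F = ⊤` iff `F = 0`. [cite: HauserPerlega2019PRIMS, §2 (ord_P)] -/
theorem ordAlong_eq_top_iff {S : Finset σ} {F : MvPolynomial σ K} : ordAlong S F = ⊤ ↔ F = 0 :=
  ⟨fun h => by_contra fun hF => ordAlong_ne_top hF h, fun h => by rw [h, ordAlong_zero]⟩

/-- Along the empty coordinate set every non-zero `F` has order `0`. [cite: HauserPerlega2019PRIMS, §2 (ord_P)] -/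
theorem ordAlong_empty {F : MvPolynomial σ K} (hF : F ≠ 0) : ordAlong (∅ : Finset σ) F = 0 := by
  obtain ⟨d, -, hd⟩ := exists_mem_support_ordAlong_eq (∅ : Finset σ) hF
  rw [hd, degIn_empty, Nat.cast_zero]

/-- **`ordAlong` of a monomial** with non-zero coefficient is its `S`-degree. [cite: HauserPerlega2019PRIMS, §2 (ord_P)] -/
theorem ordAlong_monomial (S : Finset σ) (d : σ →₀ ℕ) {c : K} (hc : c ≠ 0) :
    ordAlong S (monomial d c) = (degIn S d : ℕ∞) := by
  classical
  rw [ordAlong_eq_inf, MvPolynomial.support_monomial, if_neg hc, Finset.inf_singleton]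

/-- `ordAlong` of `X_i^n` (non-trivial coefficients): `n` if `i ∈ S`, else `0`. [cite: HauserPerlega2019PRIMS, §2 (ord_P)] -/
theorem ordAlong_X_pow [DecidableEq σ] [Nontrivial K] (S : Finset σ) (i : σ) (n : ℕ) :
    ordAlong S (X i ^ n : MvPolynomial σ K) = ((if i ∈ S then n else 0 : ℕ) : ℕ∞) := by
  rw [X_pow_eq_monomial, ordAlong_monomial S _ one_ne_zero, degIn_single]

/-- `ordAlong` of `X_i` (non-trivial coefficients): `1` if `i ∈ S`, else `0`. [cite: HauserPerlega2019PRIMS, §2 (ord_P)] -/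
theorem ordAlong_X [DecidableEq σ] [Nontrivial K] (S : Finset σ) (i : σ) :
    ordAlong S (X i : MvPolynomial σ K) = ((if i ∈ S then 1 else 0 : ℕ) : ℕ∞) := by
  rw [← pow_one (X i), ordAlong_X_pow]

/-- The coefficients of a two-monomial sum with distinct exponents. [cite: HauserPerlega2019PRIMS, §2 (ord_P)] -/
theorem coeff_monomial_add_monomial [DecidableEq σ] {d₁ d₂ : σ →₀ ℕ} (c₁ c₂ : K) (d : σ →₀ ℕ) :
    coeff d (monomial d₁ c₁ + monomial d₂ c₂) =
      (if d₁ = d then c₁ else 0) + (if d₂ = d then c₂ else 0) := by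
  rw [coeff_add, coeff_monomial, coeff_monomial]

/-- **Support of a two-monomial sum** with distinct exponents and non-zero coefficients.
[cite: HauserPerlega2019PRIMS, §2 (ord_P)] -/
theorem support_monomial_add_monomial [DecidableEq σ] {d₁ d₂ : σ →₀ ℕ} (hne : d₁ ≠ d₂) {c₁ c₂ : K}
    (h₁ : c₁ ≠ 0) (h₂ : c₂ ≠ 0) : (monomial d₁ c₁ + monomial d₂ c₂).support = {d₁, d₂} := by
  ext d
  rw [MvPolynomial.mem_support_iff, coeff_monomial_add_monomial, Finset.mem_insert,
    Finset.mem_singleton]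
  constructor
  · intro h
    by_contra hc
    push Not at hc
    rw [if_neg (Ne.symm hc.1), if_neg (Ne.symm hc.2), add_zero] at h
    exact h rfl
  · rintro (rfl | rfl)
    · rw [if_pos rfl, if_neg (Ne.symm hne), add_zero]; exact h₁
    · rw [if_neg hne, if_pos rfl, zero_add]; exact h₂

/-- A two-monomial sum with distinct exponents and non-zero coefficients is non-zero.
[cite: HauserPerlega2019PRIMS, §2 (ord_P)] -/
theorem monomial_add_monomial_ne_zero [DecidableEq σ] {d₁ d₂ : σ →₀ ℕ} (hne : d₁ ≠ d₂) {c₁ c₂ : K}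
    (h₁ : c₁ ≠ 0) (h₂ : c₂ ≠ 0) : monomial d₁ c₁ + monomial d₂ c₂ ≠ 0 := by
  intro h
  have := support_monomial_add_monomial hne h₁ h₂
  rw [h, MvPolynomial.support_zero] at this
  exact Finset.insert_ne_empty _ _ this.symm

/-- **`ordAlong` of a two-monomial sum** (distinct exponents, non-zero coefficients) is the minimum of the two
`S`-degrees. [cite: HauserPerlega2019PRIMS, §2 (ord_P)] -/
theorem ordAlong_monomial_add_monomial [DecidableEq σ] (S : Finset σ) {d₁ d₂ : σ →₀ ℕ} (hne : d₁ ≠ d₂)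
    {c₁ c₂ : K} (h₁ : c₁ ≠ 0) (h₂ : c₂ ≠ 0) :
    ordAlong S (monomial d₁ c₁ + monomial d₂ c₂) = min (degIn S d₁ : ℕ∞) (degIn S d₂ : ℕ∞) := by
  rw [ordAlong_eq_inf, support_monomial_add_monomial hne h₁ h₂, Finset.inf_insert,
    Finset.inf_singleton]

/-- **`ordAlong` of a sum of two distinct monomials with unit coefficients** — the shape of the example
polynomials of the Hauser–Perlega cycles — is the minimum of their `S`-degrees (any index type, any
non-trivial `K`). [cite: HauserPerlega2019PRIMS, §2 (ord_P)] -/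
theorem ordAlong_two_monomials [DecidableEq σ] [Nontrivial K] {d₁ d₂ : σ →₀ ℕ} (hne : d₁ ≠ d₂)
    (S : Finset σ) :
    ordAlong S (monomial d₁ (1 : K) + monomial d₂ 1) = min (degIn S d₁ : ℕ∞) (degIn S d₂ : ℕ∞) :=
  ordAlong_monomial_add_monomial S hne one_ne_zero one_ne_zero

/-- `ordAlong` is super-additive on sums: `min (ord F) (ord G) ≤ ord (F + G)`. [cite: HauserPerlega2019PRIMS, §2 (ord_P)] -/
theorem min_ordAlong_le_ordAlong_add [DecidableEq σ] (S : Finset σ) (F G : MvPolynomial σ K) :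
    min (ordAlong S F) (ordAlong S G) ≤ ordAlong S (F + G) := by
  refine le_ordAlong_iff.mpr fun d hd => ?_
  rcases Finset.mem_union.mp (MvPolynomial.support_add hd) with h | h
  · exact le_trans (min_le_left _ _) (ordAlong_le_of_mem_support h)
  · exact le_trans (min_le_right _ _) (ordAlong_le_of_mem_support h)

/-- `ordAlong` of a negation. [cite: HauserPerlega2019PRIMS, §2 (ord_P)] -/
theorem ordAlong_neg (S : Finset σ) (F : MvPolynomial σ K) : ordAlong S (-F) = ordAlong S F := by
  rw [ordAlong_eq_inf, ordAlong_eq_inf, MvPolynomial.support_neg]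

/-- `ordAlong` is super-additive on products: `ord F + ord G ≤ ord (F·G)` (the `S`-degree is additive on
exponents and `supp (F·G) ⊆ supp F + supp G`). [cite: HauserPerlega2019PRIMS, §2 (ord_P)] -/
theorem ordAlong_add_ordAlong_le_mul [DecidableEq σ] (S : Finset σ) (F G : MvPolynomial σ K) :
    ordAlong S F + ordAlong S G ≤ ordAlong S (F * G) := by
  refine le_ordAlong_iff.mpr fun d hd => ?_
  obtain ⟨a, ha, b, hb, rfl⟩ := Finset.mem_add.mp (MvPolynomial.support_mul F G hd)
  calc ordAlong S F + ordAlong S G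
      ≤ (degIn S a : ℕ∞) + (degIn S b : ℕ∞) :=
        add_le_add (ordAlong_le_of_mem_support ha) (ordAlong_le_of_mem_support hb)
    _ = (degIn S (a + b) : ℕ∞) := by
        rw [show degIn S (a + b) = degIn S a + degIn S b from by
          simp only [degIn, Finsupp.coe_add, Pi.add_apply, Finset.sum_add_distrib], Nat.cast_add]

/-- Multiplying by a constant does not lower the order along `C_S`. [cite: HauserPerlega2019PRIMS, §2 (ord_P)] -/
theorem ordAlong_le_ordAlong_C_mul [DecidableEq σ] (S : Finset σ) (c : K) (F : MvPolynomial σ K) :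
    ordAlong S F ≤ ordAlong S (C c * F) := by
  refine le_ordAlong_iff.mpr fun d hd => ordAlong_le_of_mem_support ?_
  rw [MvPolynomial.mem_support_iff] at hd ⊢
  rw [coeff_C_mul] at hd
  exact fun h => hd (by rw [h, mul_zero])

end OrdAlong

/-! ## §4 `chartTransform q S j F` -/

section ChartTransform

variable [DecidableEq σ]

/-- The chart transform summed over any finite set of exponents containing the support.
[cite: HauserPerlega2019PRIMS, §2 (the blowup in the x₁-chart)] -/
theorem chartTransform_eq_sum_of_subset (q : ℕ) (S : Finset σ) (j : σ) (F : MvPolynomial σ K)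
    {T : Finset (σ →₀ ℕ)} (hT : F.support ⊆ T) :
    chartTransform q S j F = ∑ d ∈ T, monomial (chartExponent q S j d) (coeff d F) := by
  unfold chartTransform
  refine Finset.sum_subset hT fun d _ hd => ?_
  rw [MvPolynomial.notMem_support_iff.mp hd, map_zero]

/-- The chart transform of `0`. [cite: HauserPerlega2019PRIMS, §2 (the blowup in the x₁-chart)] -/
theorem chartTransform_zero (q : ℕ) (S : Finset σ) (j : σ) :
    chartTransform q S j (0 : MvPolynomial σ K) = 0 := by
  unfold chartTransform
  rw [MvPolynomial.support_zero, Finset.sum_empty]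

/-- The chart transform is additive. [cite: HauserPerlega2019PRIMS, §2 (the blowup in the x₁-chart)] -/
theorem chartTransform_add (q : ℕ) (S : Finset σ) (j : σ) (F G : MvPolynomial σ K) :
    chartTransform q S j (F + G) = chartTransform q S j F + chartTransform q S j G := by
  rw [chartTransform_eq_sum_of_subset q S j (F + G) (MvPolynomial.support_add (p := F) (q := G)),
    chartTransform_eq_sum_of_subset q S j F (Finset.subset_union_left (s₂ := G.support)),
    chartTransform_eq_sum_of_subset q S j G (Finset.subset_union_right (s₁ := F.support)),
    ← Finset.sum_add_distrib]
  refine Finset.sum_congr rfl fun d _ => ?_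
  rw [coeff_add, map_add]

/-- The chart transform of a finite sum. [cite: HauserPerlega2019PRIMS, §2 (the blowup in the x₁-chart)] -/
theorem chartTransform_sum {ι : Type*} (q : ℕ) (S : Finset σ) (j : σ) (s : Finset ι)
    (f : ι → MvPolynomial σ K) :
    chartTransform q S j (∑ i ∈ s, f i) = ∑ i ∈ s, chartTransform q S j (f i) := by
  classical
  induction s using Finset.induction_on with
  | empty => rw [Finset.sum_empty, Finset.sum_empty, chartTransform_zero]
  | insert a s ha ih => rw [Finset.sum_insert ha, Finset.sum_insert ha, chartTransform_add, ih]

/-- **The chart transform of a monomial**: the exponent moves by the chart law, the coefficient is kept.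
[cite: HauserPerlega2019PRIMS, §2 (the blowup in the x₁-chart)] -/
theorem chartTransform_monomial (q : ℕ) (S : Finset σ) (j : σ) (d : σ →₀ ℕ) (c : K) :
    chartTransform q S j (monomial d c) = monomial (chartExponent q S j d) c := by
  classical
  by_cases hc : c = 0
  · subst hc
    rw [map_zero, map_zero, chartTransform_zero]
  · unfold chartTransform
    rw [MvPolynomial.support_monomial, if_neg hc, Finset.sum_singleton, coeff_monomial, if_pos rfl]

/-- The chart transform commutes with constants. [cite: HauserPerlega2019PRIMS, §2 (the blowup in the x₁-chart)] -/
theorem chartTransform_C_mul (q : ℕ) (S : Finset σ) (j : σ) (c : K) (F : MvPolynomial σ K) :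
    chartTransform q S j (C c * F) = C c * chartTransform q S j F := by
  have hsub : (C c * F).support ⊆ F.support := fun d hd => by
    rw [MvPolynomial.mem_support_iff] at hd ⊢
    rw [coeff_C_mul] at hd
    exact fun h => hd (by rw [h, mul_zero])
  rw [chartTransform_eq_sum_of_subset q S j _ hsub]
  unfold chartTransform
  rw [Finset.mul_sum]
  refine Finset.sum_congr rfl fun d _ => ?_
  rw [coeff_C_mul, C_mul_monomial]

/-- **The chart transform of a two-monomial sum**: both exponents move by the chart law, coefficients kept
(no hypothesis on the exponents or coefficients). [cite: HauserPerlega2019PRIMS, §2 (the blowup in the x₁-chart)] -/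
theorem chartTransform_monomial_add_monomial (q : ℕ) (S : Finset σ) (j : σ) (d₁ d₂ : σ →₀ ℕ)
    (c₁ c₂ : K) :
    chartTransform q S j (monomial d₁ c₁ + monomial d₂ c₂) =
      monomial (chartExponent q S j d₁) c₁ + monomial (chartExponent q S j d₂) c₂ := by
  rw [chartTransform_add, chartTransform_monomial, chartTransform_monomial]

/-- The chart transform of `X_i^n`. [cite: HauserPerlega2019PRIMS, §2 (the blowup in the x₁-chart)] -/
theorem chartTransform_X_pow (q : ℕ) (S : Finset σ) (j i : σ) (n : ℕ) :
    chartTransform q S j (X i ^ n : MvPolynomial σ K) =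
      monomial (chartExponent q S j (Finsupp.single i n)) 1 := by
  rw [X_pow_eq_monomial, chartTransform_monomial]

end ChartTransform

end CentreBlowup

end Literature.AlgebraicGeometry.Resolution
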